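import Summits.BirchSwinnertonDyer.BirchSwinnertonDyer.Theorems.DefiniteThetaDerivedHeightCapTowerSqrtPadicJets
import HarnessLib

/-!
# The square root along a `ℤ_p`-tower: `θ_n · ι(θ_n) ∈ I_n^{2ρ}` for all `n` ⇒ `θ_n ∈ I_n^ρ` for all `n`

Route-independent `Theorems` file (cell `b2b-bsdres`, seat `b2b-bsdres-x10b`, gen 44), part 3 of the series «tower square root»
serving crux `DerivedHeightCap` (stmt-BirchSwinnertonDyer-18438, route DefiniteTheta), registered stub `stub_towerSqrt`.
HONEST FRAMING: no curve asserted, no class closed, BSD not proved by any of this.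

**The abstract theorem** (`mem_augIdeal_pow_of_mul_inv_mem`). Let `(G_n)_{n ≥ 0}` be finite commutative groups with maps
`π_n : G_{n+1} → G_n`, coherent generators `γ_n` (`π_n γ_{n+1} = γ_n`, every element of `G_n` a power of `γ_n`), `#G_n = p^{e_n}`
with `e_n` unbounded, and let `θ_n ∈ ℤ_p[G_n]` be coherent (`π_{n*} θ_{n+1} = θ_n`). If `θ_n · ι(θ_n) ∈ I_n^{2ρ}` for every `n`
(`ι = (σ ↦ σ⁻¹)_*`, `I_n` the augmentation ideal) then `θ_n ∈ I_n^{ρ}` for every `n`.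

This is the statement "`L = θ θ^* ∈ J^{2ρ} ⇒ θ ∈ J^ρ` in `Λ = ℤ_p⟦G_∞⟧ ≅ ℤ_p⟦T⟧`" of Bertolini–Darmon 2005 §1.2 / Cor. 3 (ideals of `Λ`
are closed; `gr_J Λ` is a domain; `ι` preserves `J`), proved here WITHOUT the Iwasawa algebra, by `p`-adic jets:
polynomial lifts `F_n`, `F'_n` of `θ_n`, `ι θ_n` under `ℤ_p[X] → ℤ_p[G_n]`, `X ↦ γ_n − 1` (part 1) are coherent modulo `ω_{e_n}`,
so their low coefficients converge `p`-adically (part 2 §1, §3) to jets `a`, `b` with `Σ_{i+j=k} a_i b_j = 0` for `k < 2ρ`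
(the hypothesis kills the low coefficients of `F_n F'_n` modulo `p^{e_n − k}`); `ℤ_p[X]` is a domain, so the `a`-jet or the
`b`-jet vanishes below `ρ` (part 2 §4) — the SYMMETRY between `θ` and `ι θ` replaces "`ord(ι f) = ord f`"; a vanishing jet puts
`F_m` in `(X^ρ, ω_{e_n})` for `e_m ≫ e_n` (part 2 §2: `p^{e_n ρ} X^i ∈ (X^ρ, ω_{e_n})`; the constant terms vanish exactly because
`ε(θ_n)² = ε(θ_n ι θ_n) = 0`), hence `θ_n ∈ (γ_n − 1)^ρ = I_n^ρ`, or the same for `ι θ_n` and then `θ_n = ι ι θ_n ∈ I_n^ρ`.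
FALSE at a single finite layer (e.g. `θ = T Φ_{p²}(1+T)` in `ℤ_p[T]/(ω_2)`, `p ≥ 3`, `ρ = 2`), which is why coherence along an
UNBOUNDED tower is a hypothesis.

## References
* [BertoliniDarmon2005] §1.2 (18)–(21), Cor. 3.
* [Washington1997] §7.1, Thm. 7.1 (`Λ ≅ lim ℤ_p[Γ_n]`), §13.2.
-/

noncomputable section

open scoped BigOperators Polynomial

-- D-0017: single-problem summit, the namespace repeats the problem name by design.
set_option linter.dupNamespace false

namespace Summit.BirchSwinnertonDyer.BirchSwinnertonDyer.Theorems.TowerSqrt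

open Literature.NumberTheory.EllipticCurves (augIdeal augmentation augmentation_single mem_augIdeal_iff)

universe u

variable (p : ℕ) [hp : Fact p.Prime]

section Tower

variable {G : ℕ → Type u} [∀ n, CommGroup (G n)] (hfin : ∀ n, Finite (G n))
  (π : ∀ n, G (n + 1) →* G n) (γ : ∀ n, G n) (hγ : ∀ n, π n (γ (n + 1)) = γ n)
  (hgen : ∀ n (g : G n), ∃ k : ℕ, γ n ^ k = g)
  (e : ℕ → ℕ) (hcard : ∀ n, Nat.card (G n) = p ^ e n)

/-! ### §1 Elementary consequences of the tower data -/

omit hp in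
include hcard in
/-- `γ_n^{p^{e_n}} = 1`. [folklore] -/
theorem gen_pow_card (n : ℕ) : γ n ^ (p ^ e n) = 1 := by
  rw [← hcard n]
  exact pow_card_eq_one'

include hγ hgen in
/-- The maps `π_n` are onto (the generator `γ_n = π_n γ_{n+1}`). [folklore] -/
theorem pi_surjective (n : ℕ) : Function.Surjective (π n) := by
  intro g
  obtain ⟨k, rfl⟩ := hgen n g
  exact ⟨γ (n + 1) ^ k, by rw [map_pow, hγ]⟩

include hfin hγ hgen hcard in
/-- `e_n ≤ e_{n+1}`, hence `e` is monotone. [folklore] -/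
theorem e_monotone : Monotone e := by
  refine monotone_nat_of_le_succ fun n => ?_
  haveI := hfin (n + 1)
  have h := Nat.card_le_card_of_surjective (π n) (pi_surjective π γ hγ hgen n)
  rw [hcard, hcard] at h
  exact (Nat.pow_le_pow_iff_right hp.out.one_lt).mp h

/-! ### §2 Coherent polynomial lifts and their `p`-adic jets -/

include hfin hγ hgen hcard in
/-- **Coherent lifts**: a coherent family `θ_n ∈ ℤ_p[G_n]` (`π_{n*} θ_{n+1} = θ_n`) lifts to polynomials `F_n ∈ ℤ_p[X]`,
`F_n(γ_n − 1) = θ_n`, with `ω_{e_n} ∣ F_m − F_n` for `n ≤ m` (part 1: onto, kernel `(ω_{e_n})`, compatible with `π`).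
[cite: Washington1997, §7.1 Thm. 7.1] -/
theorem exists_coherent_lifts (θ : ∀ n, MonoidAlgebra ℤ_[p] (G n))
    (hθ : ∀ n, MonoidAlgebra.mapDomainRingHom ℤ_[p] (π n) (θ (n + 1)) = θ n) :
    ∃ F : ℕ → ℤ_[p][X], (∀ n, (Polynomial.aeval (R := ℤ_[p]) (MonoidAlgebra.of ℤ_[p] _ (γ n) - 1)) (F n) = θ n) ∧
      ∀ n m, n ≤ m → ((Polynomial.X + 1 : ℤ_[p][X]) ^ (p ^ (e n)) - 1) ∣ F m - F n := by
  choose F hF using fun n => evalGen_surjective p (γ n) (hgen n) (θ n)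
  refine ⟨F, hF, ?_⟩
  have hstep : ∀ n, ((Polynomial.X + 1 : ℤ_[p][X]) ^ (p ^ (e n)) - 1) ∣ F (n + 1) - F n := by
    intro n
    haveI := hfin n
    refine omegaPoly_dvd_of_evalGen_eq_zero p (γ n) (e n) (gen_pow_card p γ e hcard n) (hgen n) (hcard n) ?_
    rw [map_sub, hF n, ← hγ n, ← mapDomainRingHom_evalGen p (π n) (γ (n + 1)) (F (n + 1)), hF (n + 1), hθ n, sub_self]
  intro n m hnm
  induction m, hnm using Nat.le_induction with
  | base => simp
  | succ m hnm ih =>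
    have h1 : ((Polynomial.X + 1 : ℤ_[p][X]) ^ (p ^ (e n)) - 1) ∣ F (m + 1) - F m :=
      (omegaPoly_dvd_omegaPoly p (e_monotone p hfin π γ hγ hgen e hcard hnm)).trans (hstep m)
    have : F (m + 1) - F n = (F (m + 1) - F m) + (F m - F n) := by ring
    rw [this]
    exact dvd_add h1 ih

/-- **`p`-adic jets of a coherent family of lifts**: limits `a_k = lim_n coeff_k F_n` with `p^{e_n − k} ∣ a_k − coeff_k F_n`
(part 2 §1, §3). [cite: Washington1997, §7.1 Thm. 7.1] -/
theorem exists_jets (he : ∀ N : ℕ, ∃ n, N ≤ e n) (F : ℕ → ℤ_[p][X])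
    (hF : ∀ n m, n ≤ m → ((Polynomial.X + 1 : ℤ_[p][X]) ^ (p ^ (e n)) - 1) ∣ F m - F n) :
    ∃ a : ℕ → ℤ_[p], ∀ k n, (p : ℤ_[p]) ^ (e n - k) ∣ a k - (F n).coeff k := by
  have h : ∀ k, ∃ L : ℤ_[p], ∀ n, (p : ℤ_[p]) ^ (e n - k) ∣ L - (F n).coeff k := by
    intro k
    refine exists_padic_limit p (fun n => (F n).coeff k) (fun n => e n - k) (fun i => ?_) (fun n m hnm => ?_)
    · obtain ⟨n, hn⟩ := he (i + k)
      exact ⟨n, by omega⟩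
    · exact pow_dvd_coeff_sub_of_omegaPoly_dvd p (e n) k (hF n m hnm)
  choose a ha using h
  exact ⟨a, ha⟩

/-! ### §3 A vanishing jet puts `θ_n` in `I_n^ρ` -/

include hfin hγ hgen hcard in
/-- **From a vanishing jet to `θ_n ∈ I_n^ρ`**: if the lifts `F_n` of `θ_n` have zero constant terms and their jets `a_i`
vanish for `i < ρ`, then `θ_n ∈ I_n^ρ` for every `n` (choose `m` with `e_m ≥ e_n ρ + ρ`; then `F_m ∈ (X^ρ, ω_{e_n})` by part 2 §2,
and `F_n ≡ F_m`). [cite: BertoliniDarmon2005, §1.2 (18)–(21)] -/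
theorem mem_augIdeal_pow_of_jet_eq_zero (he : ∀ N : ℕ, ∃ n, N ≤ e n) (θ : ∀ n, MonoidAlgebra ℤ_[p] (G n))
    (F : ℕ → ℤ_[p][X]) (hFθ : ∀ n, (Polynomial.aeval (R := ℤ_[p]) (MonoidAlgebra.of ℤ_[p] _ (γ n) - 1)) (F n) = θ n)
    (hF : ∀ n m, n ≤ m → ((Polynomial.X + 1 : ℤ_[p][X]) ^ (p ^ (e n)) - 1) ∣ F m - F n) (h0 : ∀ n, (F n).coeff 0 = 0)
    (a : ℕ → ℤ_[p]) (ha : ∀ k n, (p : ℤ_[p]) ^ (e n - k) ∣ a k - (F n).coeff k)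
    (ρ : ℕ) (hρ : ∀ i, i < ρ → a i = 0) (n : ℕ) :
    θ n ∈ augIdeal ℤ_[p] (G n) ^ ρ := by
  -- a level m ≥ n with e m ≥ e n * ρ + ρ
  obtain ⟨m₀, hm₀⟩ := he (e n * ρ + ρ)
  set m := max n m₀ with hm
  have hnm : n ≤ m := le_max_left _ _
  have hem : e n * ρ + ρ ≤ e m := hm₀.trans (e_monotone p hfin π γ hγ hgen e hcard (le_max_right n m₀))
  -- F m ∈ (X^ρ, ω_{e n})
  have hFm : F m ∈ Ideal.span {Polynomial.X ^ ρ, ((Polynomial.X + 1 : ℤ_[p][X]) ^ (p ^ (e n)) - 1)} := by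
    refine mem_span_of_coeff p (e n) ρ (F m) (h0 m) fun i hi1 hiρ => ?_
    have h1 : (p : ℤ_[p]) ^ (e m - i) ∣ (F m).coeff i := by
      have := ha i m
      rwa [hρ i hiρ, zero_sub, dvd_neg] at this
    exact (pow_dvd_pow _ (by omega)).trans h1
  -- hence F n ∈ (X^ρ, ω_{e n})
  have hFn : F n ∈ Ideal.span {Polynomial.X ^ ρ, ((Polynomial.X + 1 : ℤ_[p][X]) ^ (p ^ (e n)) - 1)} := by
    have hdiff : F m - F n ∈ Ideal.span {Polynomial.X ^ ρ, ((Polynomial.X + 1 : ℤ_[p][X]) ^ (p ^ (e n)) - 1)} := by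
      obtain ⟨c, hc⟩ := hF n m hnm
      rw [hc]
      exact Ideal.mul_mem_right _ _ (Ideal.subset_span (by simp))
    have : F n = F m - (F m - F n) := by ring
    rw [this]
    exact Ideal.sub_mem _ hFm hdiff
  -- evaluate at γ n - 1
  obtain ⟨U, V, hUV⟩ := Ideal.mem_span_pair.mp hFn
  rw [← hFθ n, ← hUV, map_add, map_mul, map_mul, evalGen_omegaPoly p (γ n) (e n) (gen_pow_card p γ e hcard n),
    mul_zero, add_zero, map_pow, Polynomial.aeval_X, augIdeal_pow_eq_span_of_gen ℤ_[p] (γ n) (hgen n) ρ]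
  exact Ideal.mul_mem_left _ _ (Ideal.mem_span_singleton_self _)

/-! ### §4 The theorem -/

/-- `ι` commutes with the tower maps: `π_* (ι θ) = ι (π_* θ)`. [folklore] -/
theorem mapDomainRingHom_mapDomain_inv {H : Type*} [CommGroup H] {G' : Type*} [CommGroup G'] (f : G' →* H)
    (θ : MonoidAlgebra ℤ_[p] G') :
    MonoidAlgebra.mapDomainRingHom ℤ_[p] f (MonoidAlgebra.mapDomain (fun σ : G' => σ⁻¹) θ) =
      MonoidAlgebra.mapDomain (fun σ : H => σ⁻¹) (MonoidAlgebra.mapDomainRingHom ℤ_[p] f θ) := by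
  have h1 : MonoidAlgebra.mapDomain (fun σ : G' => σ⁻¹) θ = MonoidAlgebra.mapDomainRingHom ℤ_[p] (invMonoidHom : G' →* G') θ :=
    rfl
  have h2 : MonoidAlgebra.mapDomain (fun σ : H => σ⁻¹) (MonoidAlgebra.mapDomainRingHom ℤ_[p] f θ) =
      MonoidAlgebra.mapDomainRingHom ℤ_[p] (invMonoidHom : H →* H) (MonoidAlgebra.mapDomainRingHom ℤ_[p] f θ) := rfl
  rw [h1, h2, ← RingHom.comp_apply, ← RingHom.comp_apply, ← MonoidAlgebra.mapDomainRingHom_comp,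
    ← MonoidAlgebra.mapDomainRingHom_comp]
  congr 2
  ext x
  simp

include hfin hγ hgen hcard in
/-- **The square root along a `ℤ_p`-tower.** For finite commutative groups `G_n` with coherent generators `γ_n`, orders
`p^{e_n}` with `e_n` unbounded, and a coherent family `θ_n ∈ ℤ_p[G_n]`: if `θ_n · ι(θ_n) ∈ I_n^{2ρ}` for all `n` then
`θ_n ∈ I_n^ρ` for all `n` (Bertolini–Darmon 2005 §1.2: `L_p = θ θ^* ∈ J^{2ρ} ⊆ Λ ⇒ θ ∈ J^ρ`, in finite-level form).
[cite: BertoliniDarmon2005, §1.2 (18)–(21) and Cor. 3] [cite: Washington1997, §7.1 Thm. 7.1] -/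
theorem mem_augIdeal_pow_of_mul_inv_mem (he : ∀ N : ℕ, ∃ n, N ≤ e n)
    (θ : ∀ n, MonoidAlgebra ℤ_[p] (G n))
    (hθ : ∀ n, MonoidAlgebra.mapDomainRingHom ℤ_[p] (π n) (θ (n + 1)) = θ n) (ρ : ℕ)
    (hyp : ∀ n, θ n * MonoidAlgebra.mapDomain (fun σ => σ⁻¹) (θ n) ∈ augIdeal ℤ_[p] (G n) ^ (2 * ρ)) (n : ℕ) :
    θ n ∈ augIdeal ℤ_[p] (G n) ^ ρ := by
  rcases Nat.eq_zero_or_pos ρ with hρ0 | hρpos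
  · rw [hρ0, pow_zero, Ideal.one_eq_top]; exact Submodule.mem_top
  -- the involuted family is coherent too
  set θ' : ∀ n, MonoidAlgebra ℤ_[p] (G n) := fun n => MonoidAlgebra.mapDomain (fun σ => σ⁻¹) (θ n) with hθ'def
  have hθ' : ∀ n, MonoidAlgebra.mapDomainRingHom ℤ_[p] (π n) (θ' (n + 1)) = θ' n := fun n => by
    simp only [hθ'def]
    rw [mapDomainRingHom_mapDomain_inv, hθ n]
  -- lifts and jets
  obtain ⟨F, hFθ, hF⟩ := exists_coherent_lifts p hfin π γ hγ hgen e hcard θ hθ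
  obtain ⟨F', hF'θ, hF'⟩ := exists_coherent_lifts p hfin π γ hγ hgen e hcard θ' hθ'
  obtain ⟨a, ha⟩ := exists_jets p e he F hF
  obtain ⟨b, hb⟩ := exists_jets p e he F' hF'
  -- constant terms vanish: ε(θ_n)² = ε(θ_n θ'_n) = 0
  have hI : ∀ n, augIdeal ℤ_[p] (G n) ^ (2 * ρ) ≤ augIdeal ℤ_[p] (G n) := fun n =>
    Ideal.pow_le_self (by omega)
  have hε : ∀ n, augmentation ℤ_[p] (G n) (θ n) = 0 := fun n => by
    have h1 : augmentation ℤ_[p] (G n) (θ n * θ' n) = 0 := (mem_augIdeal_iff _ _).mp (hI n (hyp n))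
    rw [map_mul, hθ'def, augmentation_mapDomain_inv, mul_self_eq_zero] at h1
    exact h1
  have h0 : ∀ n, (F n).coeff 0 = 0 := fun n => by rw [← augmentation_evalGen p (γ n) (F n), hFθ n, hε n]
  have h0' : ∀ n, (F' n).coeff 0 = 0 := fun n => by
    rw [← augmentation_evalGen p (γ n) (F' n), hF'θ n, hθ'def, augmentation_mapDomain_inv, hε n]
  -- the low coefficients of F n * F' n are divisible by p^{e n - k}
  have hprod : ∀ n k, k < 2 * ρ → (p : ℤ_[p]) ^ (e n - k) ∣ (F n * F' n).coeff k := by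
    intro n k hk
    haveI := hfin n
    have hmem : θ n * θ' n ∈ Ideal.span {(MonoidAlgebra.of ℤ_[p] (G n) (γ n) - 1) ^ (2 * ρ)} := by
      rw [← augIdeal_pow_eq_span_of_gen ℤ_[p] (γ n) (hgen n) (2 * ρ)]; exact hyp n
    obtain ⟨c, hc⟩ := Ideal.mem_span_singleton'.mp hmem
    obtain ⟨P, hP⟩ := evalGen_surjective p (γ n) (hgen n) c
    have hker : (Polynomial.aeval (R := ℤ_[p]) (MonoidAlgebra.of ℤ_[p] _ (γ n) - 1)) (F n * F' n - P * Polynomial.X ^ (2 * ρ)) = 0 := by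
      rw [map_sub, map_mul, map_mul, map_pow, hFθ, hF'θ, hP, Polynomial.aeval_X, hc, sub_self]
    have hdvd := omegaPoly_dvd_of_evalGen_eq_zero p (γ n) (e n) (gen_pow_card p γ e hcard n) (hgen n) (hcard n) hker
    have h1 := pow_dvd_coeff_sub_of_omegaPoly_dvd p (e n) k hdvd
    rwa [Polynomial.coeff_mul_X_pow', if_neg (not_le.mpr hk), sub_zero] at h1
  -- the Cauchy products of the jets vanish below 2ρ
  have hjet : ∀ k, k < 2 * ρ → ∑ ij ∈ Finset.antidiagonal k, a ij.1 * b ij.2 = 0 := by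
    intro k hk
    refine eq_zero_of_forall_pow_dvd' p (fun n => e n - k) (fun i => ?_) (fun n => ?_)
    · obtain ⟨n, hn⟩ := he (i + k); exact ⟨n, by omega⟩
    · -- Σ a_i b_j ≡ Σ coeff_i F_n coeff_j F'_n = coeff_k (F_n F'_n) ≡ 0
      have hS : (p : ℤ_[p]) ^ (e n - k) ∣ ∑ ij ∈ Finset.antidiagonal k, a ij.1 * b ij.2 -
          ∑ ij ∈ Finset.antidiagonal k, (F n).coeff ij.1 * (F' n).coeff ij.2 := by
        rw [← Finset.sum_sub_distrib]
        refine Finset.dvd_sum fun ij hij => ?_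
        have hle := Finset.mem_antidiagonal.mp hij
        have h1 : (p : ℤ_[p]) ^ (e n - k) ∣ a ij.1 - (F n).coeff ij.1 :=
          (pow_dvd_pow _ (by omega)).trans (ha ij.1 n)
        have h2 : (p : ℤ_[p]) ^ (e n - k) ∣ b ij.2 - (F' n).coeff ij.2 :=
          (pow_dvd_pow _ (by omega)).trans (hb ij.2 n)
        have : a ij.1 * b ij.2 - (F n).coeff ij.1 * (F' n).coeff ij.2 =
            (a ij.1 - (F n).coeff ij.1) * b ij.2 + (F n).coeff ij.1 * (b ij.2 - (F' n).coeff ij.2) := by ring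
        rw [this]
        exact dvd_add (dvd_mul_of_dvd_left h1 _) (dvd_mul_of_dvd_right h2 _)
      have hC : ∑ ij ∈ Finset.antidiagonal k, (F n).coeff ij.1 * (F' n).coeff ij.2 = (F n * F' n).coeff k := by
        rw [Polynomial.coeff_mul]
      have := dvd_add hS (hC ▸ hprod n k hk)
      rwa [sub_add_cancel] at this
  -- the jet polynomials: X^{2ρ} ∣ A B, so X^ρ ∣ A or X^ρ ∣ B
  set A := ∑ i ∈ Finset.range (2 * ρ), Polynomial.C (a i) * Polynomial.X ^ i with hA
  set B := ∑ j ∈ Finset.range (2 * ρ), Polynomial.C (b j) * Polynomial.X ^ j with hB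
  have hAB : Polynomial.X ^ (2 * ρ) ∣ A * B := by
    rw [Polynomial.X_pow_dvd_iff]
    intro d hd
    rw [hA, hB, coeff_jet_mul_jet p a b (2 * ρ) d hd]
    exact hjet d hd
  rcases X_pow_dvd_or_of_X_pow_dvd_mul p ρ hAB with hAρ | hBρ
  · -- the a-jet vanishes below ρ
    exact mem_augIdeal_pow_of_jet_eq_zero p hfin π γ hγ hgen e hcard he θ F hFθ hF h0 a ha ρ
      (jet_eq_zero_of_X_pow_dvd p a (2 * ρ) ρ (by omega) hAρ) n
  · -- the b-jet vanishes below ρ: ι θ_n ∈ I^ρ, hence θ_n = ι ι θ_n ∈ I^ρ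
    have h' := mem_augIdeal_pow_of_jet_eq_zero p hfin π γ hγ hgen e hcard he θ' F' hF'θ hF' h0' b hb ρ
      (jet_eq_zero_of_X_pow_dvd p b (2 * ρ) ρ (by omega) hBρ) n
    rw [← mapDomain_inv_mapDomain_inv ℤ_[p] (θ n)]
    exact mapDomain_inv_mem_augIdeal_pow ℤ_[p] ρ h'

end Tower

end Summit.BirchSwinnertonDyer.BirchSwinnertonDyer.Theorems.TowerSqrt

end
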